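import Mathlib
import HarnessLib
import Summits.KontsevichZagierPeriods.KontsevichZagierPeriods.Theorems.LinRedNormalFormDihedralNormalFormStubTorusDescentAux1
import Summits.KontsevichZagierPeriods.KontsevichZagierPeriods.Theorems.LinRedNormalFormDihedralNormalFormStubAtomReductionAux1
import Summits.KontsevichZagierPeriods.KontsevichZagierPeriods.Theorems.LinRedNormalFormDihedralNormalFormStubAtomReductionAux3
import Literature.NumberTheory.Transcendental.KZGroundingRelations

/-!
# `DihedralNormalForm`, line `torus-descent-sum-shadow`, stub `stub_rebaseOne`

Stub `stub_rebaseOne` of the crux `DihedralNormalForm` (stmt-KontsevichZagierPeriods-3912): the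
bases `B p` of the torus descent (`stub_torusDescent`) of a cubical atom
`[□ᵏ⁺¹, q · xᵃ · ∏_{i ≤ j} (1 − x_{[i,j]})^{e i j}]` along a simple direction `lam ∈ {0, ±1}ᵏ⁺¹`
with AT MOST ONE `+1`-coordinate — integrands `q · g(insertNth p 1 y) · (M_p(y)^{−E} − 1)` on
`(0,1)ᵏ`, one for each entry face `x_p = 1` (`lam p = −1`) — are congruent modulo `KZ.relations`
to `ℤ`-combinations of CONVERGENT cubical atoms of dimension `≤ k`.

Proof. On the face `x_p = 1` the atom kernel is an atom kernel in the other `k` coordinates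
(`exists_atomFun_insertNth_eq`: a chord `[i, j] ≠ {p}` restricts to the chord
`(p.succAbove)⁻¹[i, j]` of `Fin k`; `e p p = 0` is forced by the chord condition). The edge `M_p`
is `0` without `+1`-coordinate (`M_p^{−E} − 1 = −1`: one atom) and the single coordinate `y_{j₀}`
otherwise; then `y^{−E} − 1` is the SAME-SIGN finite sum `∑_{n<|E|} −yⁿ(1 − y)` (`E < 0`) resp.
`∑_{n<E} y^{n−E}(1 − y)` (`E > 0`; `E ≤ a (p.succAbove j₀)` keeps the exponents natural) of atom
kernels (`exists_atomFun_twist_eq`), each absolutely integrable since all terms have the sign of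
the total (`integrableOn_of_sum_sameSign`); iterated additivity of the integrand
`KZ.of_sub_sum_integrand_mem_relations` (rule (1)) concludes.
Reference: M. Kontsevich, D. Zagier, *Periods* (2001), §1.2.
-/

noncomputable section

open MeasureTheory Set

namespace Summit.KontsevichZagierPeriods.DihedralNormalForm.TorusDescent

open Literature.NumberTheory.Transcendental
open Literature.ModelTheory.ExponentialFields
open AtomReduction

variable {k : ℕ}

/-! ### Atom kernels through a face and twisted by one coordinate -/

/-- Through the face `x_p = 1`, a chord product of `Fin (k+1)` other than the single coordinate
`x_p` is a chord product of `Fin k` (the preimage of `[i, j]` under `p.succAbove`). -/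
theorem exists_cp_insertNth_eq (p i j : Fin (k + 1)) (hij : i ≤ j) (hp : ¬(i = p ∧ j = p)) :
    ∃ i' j' : Fin k, i' ≤ j' ∧ ∀ y : Fin k → ℝ,
      (∏ l : Fin (k + 1), if i ≤ l ∧ l ≤ j then (Fin.insertNth p (1:ℝ) y : Fin (k + 1) → ℝ) l
        else (1:ℝ)) = ∏ l : Fin k, if i' ≤ l ∧ l ≤ j' then y l else (1:ℝ) := by
  classical
  obtain ⟨l₀, hl₀, hl₀p⟩ : ∃ l₀, (i ≤ l₀ ∧ l₀ ≤ j) ∧ l₀ ≠ p := by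
    by_cases hi : i = p
    · exact ⟨j, ⟨hij, le_rfl⟩, fun hj => hp ⟨hi, hj⟩⟩
    · exact ⟨i, ⟨le_rfl, hij⟩, hi⟩
  obtain ⟨m₀, rfl⟩ := Fin.exists_succAbove_eq hl₀p
  set S : Finset (Fin k) := Finset.univ.filter fun l => i ≤ p.succAbove l ∧ p.succAbove l ≤ j
    with hS
  have hmS : ∀ l, l ∈ S ↔ i ≤ p.succAbove l ∧ p.succAbove l ≤ j := fun l => by simp [hS]
  have hne : S.Nonempty := ⟨m₀, (hmS _).2 hl₀⟩
  refine ⟨S.min' hne, S.max' hne, Finset.min'_le S _ (Finset.max'_mem S hne), fun y => ?_⟩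
  rw [Fin.prod_univ_succAbove _ p]
  simp only [Fin.insertNth_apply_same, Fin.insertNth_apply_succAbove, ite_self, one_mul]
  refine Finset.prod_congr rfl fun l _ => if_congr ⟨fun hl => ?_, fun h => ?_⟩ rfl rfl
  · exact ⟨Finset.min'_le S l ((hmS l).2 hl), Finset.le_max' S l ((hmS l).2 hl)⟩
  · exact ⟨((hmS _).1 (Finset.min'_mem S hne)).1.trans (Fin.succAbove_le_succAbove_iff.2 h.1),
      (Fin.succAbove_le_succAbove_iff.2 h.2).trans ((hmS _).1 (Finset.max'_mem S hne)).2⟩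

/-- An integer power of a chord `1 - xᵢ⋯xⱼ` (`i ≤ j`) is chordal. -/
theorem isChordal_chord_zpow {i j : Fin k} (hij : i ≤ j) (n : ℤ) :
    ∃ e : Fin k → Fin k → ℤ, ∀ x : Fin k → ℝ, (∀ i, x i ∈ Ioo (0:ℝ) 1) →
      (1 - ∏ l : Fin k, if i ≤ l ∧ l ≤ j then x l else (1:ℝ)) ^ n =
        ∏ i' : Fin k, ∏ j' : Fin k, if i' ≤ j' then
          (1 - ∏ l : Fin k, if i' ≤ l ∧ l ≤ j' then x l else (1:ℝ)) ^ e i' j' else (1:ℝ) := by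
  classical
  refine ⟨fun i' j' => if i' = i ∧ j' = j then n else 0, fun x _ => ?_⟩
  symm
  rw [Finset.prod_eq_single i, Finset.prod_eq_single j]
  · simp [hij]
  · exact fun j' _ hj' => by simp [hj']
  · exact fun h => absurd (Finset.mem_univ j) h
  · exact fun i' _ hi' => Finset.prod_eq_one fun j' _ => by simp [hi']
  · exact fun h => absurd (Finset.mem_univ i) h

/-- **The face of an atom kernel is an atom kernel**: if `e p p = 0` then
`atomFun a e (insertNth p 1 y) = atomFun (a ∘ p.succAbove) e' y` on the open cube. -/
theorem exists_atomFun_insertNth_eq (a : Fin (k + 1) → ℕ) (e : Fin (k + 1) → Fin (k + 1) → ℤ)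
    (p : Fin (k + 1)) (hpp : e p p = 0) :
    ∃ e' : Fin k → Fin k → ℤ, ∀ y : Fin k → ℝ, (∀ i, y i ∈ Ioo (0:ℝ) 1) →
      atomFun a e (Fin.insertNth p (1:ℝ) y) = atomFun (fun j => a (p.succAbove j)) e' y := by
  classical
  obtain ⟨e', he'⟩ : ∃ e' : Fin k → Fin k → ℤ, ∀ y : Fin k → ℝ, (∀ i, y i ∈ Ioo (0:ℝ) 1) →
      (∏ i : Fin (k + 1), ∏ j : Fin (k + 1), if i ≤ j then
        (1 - ∏ l : Fin (k + 1), if i ≤ l ∧ l ≤ j then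
          (Fin.insertNth p (1:ℝ) y : Fin (k + 1) → ℝ) l else (1:ℝ)) ^ e i j else (1:ℝ)) =
      ∏ i' : Fin k, ∏ j' : Fin k, if i' ≤ j' then
        (1 - ∏ l : Fin k, if i' ≤ l ∧ l ≤ j' then y l else (1:ℝ)) ^ e' i' j' else (1:ℝ) := by
    refine isChordal_finset_prod _ fun i _ => isChordal_finset_prod _ fun j _ => ?_
    by_cases hij : i ≤ j
    · simp only [if_pos hij]
      by_cases hp : i = p ∧ j = p
      · obtain ⟨rfl, rfl⟩ := hp
        refine ⟨0, fun y _ => ?_⟩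
        rw [cp_self, Fin.insertNth_apply_same, sub_self, hpp, zpow_zero]
        simp
      · obtain ⟨i', j', hij', hcp⟩ := exists_cp_insertNth_eq p i j hij hp
        obtain ⟨e', he'⟩ := isChordal_chord_zpow hij' (e i j)
        exact ⟨e', fun y hy => by rw [hcp y]; exact he' y hy⟩
    · simp only [if_neg hij]
      exact isChordal_one
  refine ⟨e', fun y hy => ?_⟩
  unfold atomFun
  rw [he' y hy, Fin.prod_univ_succAbove _ p]
  simp only [Fin.insertNth_apply_same, Fin.insertNth_apply_succAbove, one_pow, one_mul]

/-- `t^{(n + d)⁺} = tⁿ · tᵈ` for `t ≠ 0` and `0 ≤ n + d`. -/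
theorem pow_toNat_add_eq {t : ℝ} (ht : t ≠ 0) (n : ℕ) (d : ℤ) (hd : 0 ≤ (n : ℤ) + d) :
    t ^ ((n : ℤ) + d).toNat = t ^ n * t ^ d :=
  calc t ^ ((n : ℤ) + d).toNat = t ^ ((((n : ℤ) + d).toNat : ℕ) : ℤ) := (zpow_natCast _ _).symm
    _ = t ^ n * t ^ d := by rw [Int.toNat_of_nonneg hd, zpow_add₀ ht, zpow_natCast]

/-- **Twisting an atom kernel** by `y_{j₀}^d · (1 - y_{j₀})` (`d : ℤ`) gives an atom kernel, as long
as the exponent of `y_{j₀}` stays natural. -/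
theorem exists_atomFun_twist_eq (a : Fin k → ℕ) (e : Fin k → Fin k → ℤ) (j₀ : Fin k) (d : ℤ)
    (hd : 0 ≤ (a j₀ : ℤ) + d) :
    ∃ (a' : Fin k → ℕ) (e' : Fin k → Fin k → ℤ), ∀ y : Fin k → ℝ, (∀ i, y i ∈ Ioo (0:ℝ) 1) →
      atomFun a e y * (y j₀ ^ d * (1 - y j₀)) = atomFun a' e' y := by
  classical
  obtain ⟨e₁, he₁⟩ := isChordal_chord (k := k) (le_refl j₀)
  obtain ⟨e', he'⟩ := isChordal_mul (g := fun y : Fin k → ℝ => 1 - y j₀) ⟨e, fun y _ => rfl⟩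
    ⟨e₁, fun y hy => by rw [← he₁ y hy, cp_self]⟩
  set a' : Fin k → ℕ := fun j => if j = j₀ then ((a j₀ : ℤ) + d).toNat else a j with ha'
  refine ⟨a', e', fun y hy => ?_⟩
  have hmono : (∏ j, y j ^ a' j) = (∏ j, y j ^ a j) * y j₀ ^ d := by
    have h : ∀ j, y j ^ a' j = y j ^ a j * (if j = j₀ then y j₀ ^ d else 1) := by
      intro j
      simp only [ha']
      by_cases hj : j = j₀
      · rw [if_pos hj, if_pos hj, hj]
        exact pow_toNat_add_eq (hy j₀).1.ne' _ _ hd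
      · rw [if_neg hj, if_neg hj, mul_one]
    rw [Finset.prod_congr rfl fun j _ => h j, Finset.prod_mul_distrib, Finset.prod_ite_eq']
    simp
  unfold atomFun
  rw [hmono, ← he' y hy]
  ring

/-- With no `+1`-coordinate off the face, `topP = 0`. -/
theorem topP_eq_zero_of_forall_ne (lam : Fin (k + 1) → ℤ) (p : Fin (k + 1)) (y : Fin k → ℝ)
    (h : ∀ j, lam (Fin.succAbove p j) ≠ 1) : topP lam p y = 0 :=
  (topP_eq_zero_or lam p y).elim id fun ⟨j, hj, _⟩ => absurd hj (h j)

/-- With exactly one `+1`-coordinate `j₀` (and `0 ≤ y_{j₀}`), `topP = y_{j₀}`. -/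
theorem topP_eq_apply (lam : Fin (k + 1) → ℤ) (p : Fin (k + 1)) (y : Fin k → ℝ) {j₀ : Fin k}
    (hj₀ : lam (Fin.succAbove p j₀) = 1) (huniq : ∀ j, lam (Fin.succAbove p j) = 1 → j = j₀)
    (hy : 0 ≤ y j₀) : topP lam p y = y j₀ :=
  le_antisymm (topP_le lam p y hy fun j hj => by rw [huniq j hj]) (le_topP lam p y hj₀)

/-- `E < 0`: `t^{-E} - 1 = ∑_{n<|E|} -(tⁿ (1 - t))`. -/
theorem zpow_neg_sub_one_of_neg {E : ℤ} (hE : E < 0) (t : ℝ) :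
    t ^ (-E) - 1 = ∑ n ∈ Finset.range E.natAbs, -(t ^ (n : ℤ) * (1 - t)) := by
  have hN : ((E.natAbs : ℕ) : ℤ) = -E := Int.ofNat_natAbs_of_nonpos hE.le
  rw [← hN, zpow_natCast, ← geom_sum_mul, Finset.sum_mul]
  refine Finset.sum_congr rfl fun n _ => ?_
  rw [zpow_natCast]
  ring

/-- `E > 0`, `t ≠ 0`: `t^{-E} - 1 = ∑_{n<E} t^{n-E} (1 - t)`. -/
theorem zpow_neg_sub_one_of_pos {E : ℤ} (hE : 0 < E) {t : ℝ} (ht : t ≠ 0) :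
    t ^ (-E) - 1 = ∑ n ∈ Finset.range E.natAbs, t ^ ((n : ℤ) - E) * (1 - t) := by
  have hN : ((E.natAbs : ℕ) : ℤ) = E := Int.natAbs_of_nonneg hE.le
  have h1 : t ^ (-E) - 1 = t ^ (-E) * (1 - t ^ E.natAbs) := by
    rw [mul_sub, mul_one, ← zpow_natCast, hN, ← zpow_add₀ ht, neg_add_cancel, zpow_zero]
  have h2 : (1:ℝ) - t ^ E.natAbs = (∑ n ∈ Finset.range E.natAbs, t ^ n) * (1 - t) := by
    linear_combination geom_sum_mul t E.natAbs
  rw [h1, h2, ← mul_assoc, Finset.mul_sum, Finset.sum_mul]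
  refine Finset.sum_congr rfl fun n _ => ?_
  rw [show (n : ℤ) - E = (n : ℤ) + -E from sub_eq_add_neg _ _, zpow_add₀ ht, zpow_natCast]
  ring

/-! ### Sums of atoms -/

/-- The atom kernel is measurable. -/
theorem measurable_atomFun (a : Fin k → ℕ) (e : Fin k → Fin k → ℤ) : Measurable (atomFun a e) := by
  unfold atomFun
  refine Measurable.mul (Finset.measurable_prod _ fun i _ => (measurable_pi_apply i).pow_const _)
    (Finset.measurable_prod _ fun i _ => Finset.measurable_prod _ fun j _ => ?_)
  by_cases hij : i ≤ j
  · simp only [if_pos hij]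
    refine (measurable_const.sub (Finset.measurable_prod _ fun l _ => ?_)).pow_const _
    by_cases hl : i ≤ l ∧ l ≤ j
    · simpa only [if_pos hl] using measurable_pi_apply l
    · simpa only [if_neg hl] using measurable_const
  · simpa only [if_neg hij] using measurable_const

/-- **The convergent atom** `[(0,1)ᵏ, q · atomFun a e]` attached to an absolutely integrable atom
kernel (`ℚ`-semialgebraic by `isSemialgebraicFunOn_atomFun_comp`). -/
theorem exists_atomRep_of_integrableOn (q : ℚ) (a : Fin k → ℕ) (e : Fin k → Fin k → ℤ)
    (hint : IntegrableOn (atomFun a e) {x : Fin k → ℝ | ∀ i, x i ∈ Ioo (0:ℝ) 1}) :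
    ∃ s : KZ.IntegralRep k, s.domain = {x : Fin k → ℝ | ∀ i, x i ∈ Ioo (0:ℝ) 1} ∧
      s.integrand = fun x => (q : ℝ) * atomFun a e x :=
  have hS : IsSemialgebraic ℚ {x : Fin k → ℝ | ∀ i, x i ∈ Ioo (0:ℝ) 1} :=
    isSemialgebraic_openUnitCube
  ⟨{ domain := {x : Fin k → ℝ | ∀ i, x i ∈ Ioo (0:ℝ) 1}
     integrand := fun x => (q : ℝ) * atomFun a e x
     isSemialgebraic_domain := hS
     isSemialgebraicFunOn_integrand := (isSemialgebraicFunOn_const_ratCast hS q).fun_mul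
       (isSemialgebraicFunOn_atomFun_comp hS a e (X := fun x => x)
         fun i => isSemialgebraicFunOn_apply hS i)
     integrableOn := hint.const_mul _ }, rfl, rfl⟩

/-- **Same-sign domination**: the terms of an integrable finite sum of functions which all have the
same sign at every point are integrable. -/
theorem integrableOn_of_sum_sameSign {N : ℕ} {S : Set (Fin k → ℝ)} (hS : MeasurableSet S)
    (f : Fin N → (Fin k → ℝ) → ℝ) (hmeas : ∀ n, Measurable (f n))
    (hsign : ∀ x ∈ S, (∀ n, 0 ≤ f n x) ∨ (∀ n, f n x ≤ 0))
    (hint : IntegrableOn (fun x => ∑ n, f n x) S) (n : Fin N) : IntegrableOn (f n) S := by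
  refine Integrable.mono' hint.norm (hmeas n).aestronglyMeasurable ?_
  refine (ae_restrict_iff' hS).2 (Filter.Eventually.of_forall fun x hx => ?_)
  rw [Real.norm_eq_abs, Real.norm_eq_abs]
  rcases hsign x hx with h | h
  · rw [abs_of_nonneg (h n), abs_of_nonneg (Finset.sum_nonneg fun m _ => h m)]
    exact Finset.single_le_sum (fun m _ => h m) (Finset.mem_univ n)
  · rw [abs_of_nonpos (h n), abs_of_nonpos (Finset.sum_nonpos fun m _ => h m),
      ← Finset.sum_neg_distrib]
    exact Finset.single_le_sum (f := fun m => -f m x) (fun m _ => neg_nonneg.2 (h m))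
      (Finset.mem_univ n)

/-- **A representation on the open cube whose integrand is a finite sum of atom kernels with a
common non-zero rational coefficient** is congruent, modulo `KZ.relations`, to the sum of the
corresponding (convergent) atoms (iterated rule (1)). -/
theorem exists_mem_closure_of_eqOn_sum {G : Set KZ.FormalRep}
    (hG : ∀ (q : ℚ) (a : Fin k → ℕ) (e : Fin k → Fin k → ℤ) (s : KZ.IntegralRep k),
      s.domain = {x : Fin k → ℝ | ∀ i, x i ∈ Ioo (0:ℝ) 1} →
      s.integrand = (fun x => (q : ℝ) * atomFun a e x) → KZ.of s ∈ G)
    (s : KZ.IntegralRep k) (hdom : s.domain = {x : Fin k → ℝ | ∀ i, x i ∈ Ioo (0:ℝ) 1})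
    (q : ℚ) (hq : q ≠ 0) {N : ℕ} (an : Fin N → Fin k → ℕ) (en : Fin N → Fin k → Fin k → ℤ)
    (hsum : EqOn s.integrand (fun x => ∑ n, (q : ℝ) * atomFun (an n) (en n) x) s.domain) :
    ∃ m ∈ AddSubgroup.closure G, KZ.of s - m ∈ KZ.relations := by
  classical
  have hq' : (q : ℝ) ≠ 0 := Rat.cast_ne_zero.2 hq
  have hint : ∀ n, IntegrableOn (fun x => atomFun (an n) (en n) x)
      {x : Fin k → ℝ | ∀ i, x i ∈ Ioo (0:ℝ) 1} := by
    intro n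
    have h := integrableOn_of_sum_sameSign (measurableSet_cube k)
      (fun n x => (q : ℝ) * atomFun (an n) (en n) x)
      (fun n => measurable_const.mul (measurable_atomFun _ _)) ?_ ?_ n
    · have h2 : IntegrableOn (fun x => (q : ℝ)⁻¹ * ((q : ℝ) * atomFun (an n) (en n) x))
          {x : Fin k → ℝ | ∀ i, x i ∈ Ioo (0:ℝ) 1} := h.const_mul _
      refine h2.congr_fun (fun x _ => ?_) (measurableSet_cube k)
      simp only [inv_mul_cancel_left₀ hq']
    · intro x hx
      rcases lt_or_gt_of_ne hq with hneg | hpos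
      · exact Or.inr fun n => mul_nonpos_of_nonpos_of_nonneg (by exact_mod_cast hneg.le)
          (atomFun_nonneg (an n) (en n) hx)
      · exact Or.inl fun n => mul_nonneg (by exact_mod_cast hpos.le) (atomFun_nonneg _ _ hx)
    · rw [← hdom]
      exact s.integrableOn.congr_fun hsum (hdom ▸ measurableSet_cube k)
  choose R hRd hRi using fun n => exists_atomRep_of_integrableOn q (an n) (en n) (hint n)
  refine ⟨∑ n, KZ.of (R n),
    sum_mem fun n _ => AddSubgroup.subset_closure (hG q (an n) (en n) (R n) (hRd n) (hRi n)), ?_⟩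
  refine KZ.of_sub_sum_integrand_mem_relations Finset.univ R s (fun n _ => by rw [hRd, hdom])
    fun x hx => ?_
  rw [hsum hx]
  simp only [hRi, atomFun]

/-- Summing congruences `F i ≡ m i` over a finite type. -/
theorem exists_sum_sub_mem_relations {G : Set KZ.FormalRep} {ι : Type*} [Fintype ι]
    (F : ι → KZ.FormalRep) (h : ∀ i, ∃ m ∈ AddSubgroup.closure G, F i - m ∈ KZ.relations) :
    ∃ m ∈ AddSubgroup.closure G, (∑ i, F i) - m ∈ KZ.relations := by
  choose m hm hrel using h
  refine ⟨∑ i, m i, sum_mem fun i _ => hm i, ?_⟩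
  rw [← Finset.sum_sub_distrib]
  exact sum_mem fun i _ => hrel i

/-- **Rebasing one entry face.** For `lam p = -1`, at most one `+1`-coordinate in total and
`e p p = 0`, a representation on `(0,1)ᵏ` with integrand
`q · atomFun a e (insertNth p 1 y) · (topP^{−E} − 1)` is congruent modulo `KZ.relations` to a
`ℤ`-combination of convergent atoms of dimension `k`. -/
theorem face_mem_closure {G : Set KZ.FormalRep}
    (hG : ∀ (q : ℚ) (a : Fin k → ℕ) (e : Fin k → Fin k → ℤ) (s : KZ.IntegralRep k),
      s.domain = {x : Fin k → ℝ | ∀ i, x i ∈ Ioo (0:ℝ) 1} →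
      s.integrand = (fun x => (q : ℝ) * atomFun a e x) → KZ.of s ∈ G)
    (q : ℚ) (a : Fin (k + 1) → ℕ) (e : Fin (k + 1) → Fin (k + 1) → ℤ) (lam : Fin (k + 1) → ℤ)
    (p : Fin (k + 1)) (hlam : ∀ l, lam l = 0 ∨ lam l = 1 ∨ lam l = -1) (hp : lam p = -1)
    (hone : (Finset.univ.filter fun l : Fin (k + 1) => lam l = 1).card ≤ 1) (hpp : e p p = 0)
    (hE : wt a lam ≠ 0) (s : KZ.IntegralRep k)
    (hdom : s.domain = {x : Fin k → ℝ | ∀ i, x i ∈ Ioo (0:ℝ) 1})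
    (hint : EqOn s.integrand (fun y => (q : ℝ) * atomFun a e (Fin.insertNth p (1:ℝ) y) *
      (topP lam p y ^ (-(wt a lam)) - 1)) s.domain) :
    ∃ m ∈ AddSubgroup.closure G, KZ.of s - m ∈ KZ.relations := by
  classical
  by_cases hq : q = 0
  · exact ⟨0, zero_mem _, by simpa using
      KZ.of_mem_relations_of_eqOn_zero s fun y hy => by rw [hint hy, hq]; simp⟩
  obtain ⟨e', he'⟩ := exists_atomFun_insertNth_eq a e p hpp
  have hmem : ∀ y, y ∈ s.domain → ∀ i, y i ∈ Ioo (0:ℝ) 1 := fun y hy => by rwa [hdom] at hy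
  have huniq : ∀ l l', lam l = 1 → lam l' = 1 → l = l' := fun l l' hl hl' =>
    Finset.card_le_one.1 hone l (by simpa using hl) l' (by simpa using hl')
  by_cases hP : ∃ j₀, lam (Fin.succAbove p j₀) = 1
  · -- one `+1`-coordinate `j₀`: `topP = y_{j₀}`
    obtain ⟨j₀, hj₀⟩ := hP
    have hj : ∀ j, lam (Fin.succAbove p j) = 1 → j = j₀ := fun j hj =>
      Fin.succAbove_right_injective (huniq _ _ hj hj₀)
    -- the weight is at most `a (p.succAbove j₀)`
    have hEle : wt a lam ≤ a (p.succAbove j₀) := by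
      unfold wt
      rw [← Finset.add_sum_erase _ _ (Finset.mem_univ (p.succAbove j₀)), ← Finset.add_sum_erase _ _
        (Finset.mem_erase.2 ⟨(Fin.succAbove_ne p j₀).symm, Finset.mem_univ p⟩), hj₀, hp]
      have hrest : ∑ l ∈ (Finset.univ.erase (p.succAbove j₀)).erase p,
          lam l * ((a l : ℤ) + 1) ≤ 0 := by
        refine Finset.sum_nonpos fun l hl => ?_
        simp only [Finset.mem_erase] at hl
        have hl1 : lam l ≠ 1 := fun h => hl.2.1 (huniq _ _ h hj₀)
        have h0 : (0:ℤ) ≤ a l := Nat.cast_nonneg _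
        rcases hlam l with h | h | h
        · rw [h]; simp
        · exact absurd h hl1
        · rw [h]; linarith
      have h0 : (0:ℤ) ≤ a p := Nat.cast_nonneg _
      linarith
    rcases lt_or_gt_of_ne hE with hneg | hpos
    · -- `E < 0`: the terms `-q · atomFun a' e' y · y_{j₀}ⁿ (1 - y_{j₀})`
      have hterm : ∀ n : Fin (wt a lam).natAbs, ∃ (a'' : Fin k → ℕ) (e'' : Fin k → Fin k → ℤ),
          ∀ y : Fin k → ℝ, (∀ i, y i ∈ Ioo (0:ℝ) 1) →
            atomFun (fun j => a (p.succAbove j)) e' y * (y j₀ ^ ((n : ℕ) : ℤ) * (1 - y j₀)) =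
              atomFun a'' e'' y := fun n =>
        exists_atomFun_twist_eq _ e' j₀ _ (by positivity)
      choose an en hterm using hterm
      refine exists_mem_closure_of_eqOn_sum hG s hdom (-q) (neg_ne_zero.2 hq) an en fun y hy => ?_
      have hy' := hmem y hy
      refine (hint hy).trans ?_
      show (q : ℝ) * atomFun a e (Fin.insertNth p 1 y) * (topP lam p y ^ (-wt a lam) - 1) = _
      rw [he' y hy', topP_eq_apply lam p y hj₀ hj (hy' j₀).1.le, zpow_neg_sub_one_of_neg hneg,
        Finset.sum_range, Finset.mul_sum]
      refine Finset.sum_congr rfl fun n _ => ?_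
      rw [← hterm n y hy', Rat.cast_neg]
      ring
    · -- `E > 0`: the terms `q · atomFun a' e' y · y_{j₀}^{n - E} (1 - y_{j₀})`
      have hterm : ∀ n : Fin (wt a lam).natAbs, ∃ (a'' : Fin k → ℕ) (e'' : Fin k → Fin k → ℤ),
          ∀ y : Fin k → ℝ, (∀ i, y i ∈ Ioo (0:ℝ) 1) →
            atomFun (fun j => a (p.succAbove j)) e' y *
              (y j₀ ^ (((n : ℕ) : ℤ) - wt a lam) * (1 - y j₀)) = atomFun a'' e'' y := fun n =>
        exists_atomFun_twist_eq _ e' j₀ _ (by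
          have h0 : (0:ℤ) ≤ ((n : ℕ) : ℤ) := Nat.cast_nonneg _
          show (0:ℤ) ≤ (a (p.succAbove j₀) : ℤ) + (((n : ℕ) : ℤ) - wt a lam)
          linarith)
      choose an en hterm using hterm
      refine exists_mem_closure_of_eqOn_sum hG s hdom q hq an en fun y hy => ?_
      have hy' := hmem y hy
      refine (hint hy).trans ?_
      show (q : ℝ) * atomFun a e (Fin.insertNth p 1 y) * (topP lam p y ^ (-wt a lam) - 1) = _
      rw [he' y hy', topP_eq_apply lam p y hj₀ hj (hy' j₀).1.le,
        zpow_neg_sub_one_of_pos hpos (hy' j₀).1.ne', Finset.sum_range, Finset.mul_sum]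
      refine Finset.sum_congr rfl fun n _ => ?_
      rw [← hterm n y hy']
      ring
  · -- no `+1`-coordinate: `topP = 0`, a single atom `-q · atomFun a' e'`
    push Not at hP
    refine exists_mem_closure_of_eqOn_sum hG s hdom (-q) (neg_ne_zero.2 hq)
      (fun _ : Fin 1 => fun j => a (p.succAbove j)) (fun _ => e') fun y hy => ?_
    have hy' := hmem y hy
    refine (hint hy).trans ?_
    show (q : ℝ) * atomFun a e (Fin.insertNth p 1 y) * (topP lam p y ^ (-wt a lam) - 1) =
      ∑ n : Fin 1, ((-q : ℚ) : ℝ) * atomFun (fun j => a (p.succAbove j)) e' y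
    rw [he' y hy', topP_eq_zero_of_forall_ne lam p y hP, zero_zpow _ (neg_ne_zero.2 hE),
      Fin.sum_univ_one, Rat.cast_neg]
    ring

/-- **Stub `stub_rebaseOne`** of the line `torus-descent-sum-shadow`: the bases of the torus
descent of a simple-descent atom with at most one `+1`-coordinate are `ℤ`-combinations of convergent
cubical atoms of lower dimension, modulo `KZ.relations`. -/
theorem stub_rebaseOne : ∀ (k : ℕ) (q : ℚ) (a : Fin (k + 1) → ℕ) (e : Fin (k + 1) → Fin (k + 1) → ℤ) (lam : Fin (k + 1) → ℤ) (B : Fin (k + 1) → Literature.NumberTheory.Transcendental.KZ.IntegralRep k), (∀ l : Fin (k + 1), lam l = 0 ∨ lam l = 1 ∨ lam l = -1) → (∃ p : Fin (k + 1), lam p = -1) → (Finset.univ.filter (fun l : Fin (k + 1) => lam l = 1)).card ≤ 1 → (∀ i j : Fin (k + 1), i ≤ j → e i j ≠ 0 → (∑ l : Fin (k + 1), if i ≤ l ∧ l ≤ j then lam l else 0) = 0 ∧ (Finset.univ.filter (fun l : Fin (k + 1) => i ≤ l ∧ l ≤ j ∧ lam l = 1)).card ≤ 1) → (∑ l : Fin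 (k + 1), lam l * ((a l : ℤ) + 1)) ≠ 0 → (∀ p : Fin (k + 1), lam p = -1 → (B p).domain = {y : Fin k → ℝ | ∀ i, y i ∈ Set.Ioo (0:ℝ) 1} ∧ Set.EqOn (B p).integrand (fun y => (q : ℝ) * ((∏ i : Fin (k + 1), (Fin.insertNth p (1:ℝ) y) i ^ a i) * ∏ i : Fin (k + 1), ∏ j : Fin (k + 1), if i ≤ j then (1 - (∏ l : Fin (k + 1), if i ≤ l ∧ l ≤ j then (Fin.insertNth p (1:ℝ) y) l else 1)) ^ e i j else 1) * ((⨆ j : Fin k, if lam (Fin.succAbove p j) = 1 then y j else (0:ℝ)) ^ (-(∑ l : Fin (k + 1), lam l * ((a l : ℤ) + 1))) - 1)) (B p).domain) → ∃ m ∈ AddSubgroup.closure {z : Literature.NumberTheory.Transcendental.KZ.FormalRep | ∃ d : ℕ, d ≤ k ∧ z ∈ {z : Literature.NumberTheory.Transcendental.KZ.FormalRep | ∃ (q : ℚ) (a : Fin d → ℕ) (e : Fin d → Fin d → ℤ) (s : Literature.NumberTheory.Transcendental.KZ.IntegralRep d), s.domain = {x : Fin d → ℝ | ∀ i, x i ∈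 Set.Ioo (0:ℝ) 1} ∧ Set.EqOn s.integrand (fun x => (q : ℝ) * ((∏ i : Fin d, x i ^ a i) * ∏ i : Fin d, ∏ j : Fin d, if i ≤ j then (1 - (∏ l : Fin d, if i ≤ l ∧ l ≤ j then x l else 1)) ^ e i j else 1)) s.domain ∧ z = Literature.NumberTheory.Transcendental.KZ.of s}}, (∑ p : Fin (k + 1), if lam p = -1 then Literature.NumberTheory.Transcendental.KZ.of (B p) else 0) - m ∈ Literature.NumberTheory.Transcendental.KZ.relations := by
  intro k q a e lam B hlam _ hone hch hE hB
  classical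
  -- `e p p = 0` on every entry face (the chord `{p}` is not balanced)
  have hpp : ∀ p : Fin (k + 1), lam p = -1 → e p p = 0 := fun p hp => by
    by_contra h
    have h1 := (hch p p le_rfl h).1
    have hiff : ∀ l : Fin (k + 1), (p ≤ l ∧ l ≤ p) ↔ p = l := fun l =>
      ⟨fun h => le_antisymm h.1 h.2, fun h => h ▸ ⟨le_rfl, le_rfl⟩⟩
    simp_rw [hiff, Finset.sum_ite_eq, Finset.mem_univ, if_true, hp] at h1
    norm_num at h1
  refine exists_sum_sub_mem_relations _ fun p => ?_
  by_cases hp : lam p = -1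
  · rw [if_pos hp]
    obtain ⟨hdom, hint⟩ := hB p hp
    refine face_mem_closure (fun q' a' e' s' hd hi => ?_) q a e lam p hlam hp hone (hpp p hp) hE
      (B p) hdom hint
    simp only [Set.mem_setOf_eq]
    exact ⟨k, le_rfl, q', a', e', s', hd, fun x _ => by simp only [hi, atomFun], rfl⟩
  · exact ⟨0, zero_mem _, by rw [if_neg hp, sub_zero]; exact zero_mem _⟩

end Summit.KontsevichZagierPeriods.DihedralNormalForm.TorusDescent
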